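import Literature.MathematicalPhysics.QuantumFieldTheory.Balaban1983to89.B9Cor36CubeCutoffs
import Literature.MathematicalPhysics.QuantumFieldTheory.Balaban1983to89.B9Eq369Product
import Literature.Analysis.Complex.RungeUnits
import Literature.MathematicalPhysics.QuantumFieldTheory.Balaban1983to89.B9CubeGeometryInputs

/-!
# `Balaban1983to89.B9Cor36GCubeWindowsPointwise` — [B9] (3.37) p. 396 ∕ (3.69) p. 404 FOR COR. 3.6's CUBE CONFIGURATION `Ṽ_□ = e^{iηχ̃_□A}`, POINTWISE: the
# dictionary `Ṽ_□ =` r06's product configuration over the trivial background, def-Y's holonomy `=` the (3.1) plaquette word, and the three small-field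
# WINDOWS of G-F5a's estimates file at a site ∕ plaquette from LOCAL readings of `Ã = χ̃_□A` — (W1) `‖Ṽ_κ(y) − 1‖ ≤ η‖Ã_κ(y)‖e^{η‖Ã_κ(y)‖}`, (W2)
# `‖Ṽ_κ(y) − Ṽ_κ(y′)‖ ≤ η‖Ã_κ(y) − Ã_κ(y′)‖e^{r}`, (W3) `‖Ṽ(∂p) − 1‖ ≤ e^{6cη∕λ}(2c + 18c²)(η∕λ)²` (r06's second-order plaquette bound) and `‖Re − 1‖, ‖Im‖ ≤ ‖Ṽ(∂p) − 1‖` —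
# plus the LEVEL SLACK of the distance-2 block neighbourhood (levels differ by ≤ 1 once `R·L·M_h > 3`) (sub-row G-B9-LETTERS, module M5.1b-G, smallness bridge part I)

T. Bałaban, *Propagators for lattice gauge theories in a background field*, Commun. Math. Phys. **99** (1985) 389–434
[`Balaban1985BackgroundPropagators`, "B9"]; [4] = Commun. Math. Phys. **96** (1984) 223–250 [`Balaban1984PropagatorsII`].

statement-level skeleton of published theorems with citation tags; proofs where landed; nothing here is a claim about the
Yang–Mills mass gap

THE PRINTED LOCUS.  p. 396 (3.37): the fluctuation field `A` with `U′ = e^{iηA}`, `|A| < α₁(Lʲη)⁻¹`, `|∇^η_UA| < α₁(Lʲη)⁻²` on `Ω_j`; p. 404 below (3.69): *«This bound follows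
from the estimates [on Re U′U(∂p), Im U′U(∂p)] … the estimates follow directly from the assumptions (3.35), (3.37).»*; p. 408 Cor. 3.6's road: the propagator of the
cube `□` is expanded at `U = 1` around the cut fluctuation `χ̃_□A` (p33's `locCfgY i □ η A = e^{iηχ̃_□A}·1`).

WHY THIS FILE (cell `lit-balaban`, sub-row G-B9-LETTERS; module M5.1b-G).  G-F5a's estimates file `B9Ineq373HessianPieceBoundsY` (p649571) takes three WINDOWS on the
configuration `V` — bond `‖V − 1‖`, variation `‖V(y) − V(y − e_μ)‖`, plaquette `‖Re V(∂p) − 1‖, ‖Im V(∂p)‖` — in a block-neighbourhood form; G-F5c takes the level-by-level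
smallness `hsm`.  For `V = Ṽ_□` these are (3.37)-readings of `Ã = χ̃_□A`.  THIS FILE is the pointwise half of that bridge: the dictionary to r06's carrier-generic
second-order plaquette calculus (`B9Eq369Product`, `prodCfg 1 η Ã`, `plaqU` of the torus translations) and to the Banach-algebra Lipschitz bound of `exp`
(`Literature.Analysis.Complex.RungeUnits.norm_exp_sub_exp_le`), the three windows at a point from local readings, and the level slack lemma that lets a window at a
point's own block scale serve every block within graph distance `2` (one factor `L`).  Part II (successor) wires p33's `readings337_locFld` (chart form, weight `len`)
into the exact hypotheses `hW1`∕`hW2`∕`hW3` of `hasMajorant_V0Y`∕`hasMajorant_V1Y` and G-F5c's `hsm`.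

WHAT THIS FILE PROVES (THEOREMS only; 0 `def`, 0 `def … : Prop`, 0 sorry).
§1 `locCfgY_eq_prodCfg` (`Ṽ_□ = prodCfg 1 η (χ̃_□A)`), `holY_eq_plaqU` (`holY i V ⟨x,μ,ν⟩ = plaqU (shiftsV1) V μ ν x`, `rfl`), `norm_re_sub_one_le`, `norm_im_le`,
`norm_reHolY_imHolY_le` (`‖reHolY V p − 1‖, ‖imHolY V p‖ ≤ ‖holY V p − 1‖` for a bi-contractive holonomy); §2 (`NormOneClass 𝔸`) `val_prodCfg_one`,
★ `norm_prodCfg_one_sub_one_le` (W1), ★ `norm_prodCfg_one_sub_le` (W2); §3 ★ `norm_holY_prodCfg_sub_one_le` (W3, r06's `norm_fluct_plaq_sub_one_le_xi` at the torus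
translations, flat `covD` = forward difference); §4 ★ `scale_sub_le_one_of_dist_le_two` (`2 < RM1 i` ∧ `d(a,a′) ≤ 2 ⇒ |n(a) − n(a′)| ≤ 1`, from p33's `levelGap_geoCK`),
★ `len_le_L_mul_len_of_dist_le_two` (`len(a′) ≤ L·len(a)`).

HONEST SCOPE.  Dictionary + pointwise inequalities over landed modules (p33's `locCfgY`, r06's `B9Eq369Product`, `RungeUnits`, def-Y, p33's cube geometry); the
(3.37) readings themselves, bi-contractivity ∕ unitarity of `Ṽ`, and the block-neighbourhood wiring are NOT here.  Count-neutral; NOT a node discharge; no summit ∕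
sub-problem statement is proved; nothing continuum ∕ OS ∕ mass-gap ∕ Clay; YM mass gap NOT proved by any of this (Track A conditional rung).  No `sorry`, no `axiom`,
no `… : Prop` fact, no `instance`, no `notation`.  NEW file; nothing landed is modified.  Cell `lit-balaban`, seat `lit-balaban-p38` gen 42, 2026-08-28;
`--supports stmt-QuantumFields-19200`.  Net new unproved facts: 0.

RELATED IN THE TREE, NOT DUPLICATED: r06's `B9Eq369Product` (the plaquette calculus, used BY NAME), r05's `B9Eq358TaxiLettersY.norm_fluct_sub_one_le` (W1 in the
`η‖a‖ ≤ x ≤ 1∕4` form), p33's site-sector smallness for `locCfgY` (`B9Cor36CubeCutoffs`), my lineage's `B9Thm310CommutatorDataOfPlaquettes` (box-chart `plaqU = holY`).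
-/

noncomputable section

namespace Literature.MathematicalPhysics.QuantumFieldTheory.Balaban1983to89.B9Cor36GCubeWindowsPointwise

open NormedSpace Complex
open Node00
open Literature.MathematicalPhysics.QuantumFieldTheory.Balaban1983to89
open Literature.MathematicalPhysics.QuantumFieldTheory.Balaban1983to89.B6KLevelCensusIndexV1 (KIdx)
open Literature.MathematicalPhysics.QuantumFieldTheory.Balaban1983to89.B6GlobalChartV1 (PV)
open Literature.MathematicalPhysics.QuantumFieldTheory.Balaban1983to89.B6Cover236MultiLevelBlocks (cubes)
open Literature.MathematicalPhysics.QuantumFieldTheory.Balaban1983to89.B9Eq39Adjoint (plaqU prodCfg fluct covD)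
open Literature.MathematicalPhysics.QuantumFieldTheory.Balaban1983to89.B9BackgroundsKLevelV1 (shiftsV1)
open Literature.MathematicalPhysics.QuantumFieldTheory.Balaban1983to89.B9Cor36CubeCutoffs (locCfgY locCfgY_apply chiTY)
open Literature.MathematicalPhysics.QuantumFieldTheory.Balaban1983to89.B9Cor36CutoffField337 (cutFldY)
open Literature.MathematicalPhysics.QuantumFieldTheory.Balaban1983to89.B9Eq360DeltaPrimeAY (mulY AfldY)
open Literature.MathematicalPhysics.QuantumFieldTheory.Balaban1983to89.B9Eq369Product (val_fluct val_prodCfg norm_fluct_plaq_sub_one_le_xi)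
open Literature.MathematicalPhysics.QuantumFieldTheory.Balaban1983to89.B9CubeLettersBondOpsL0 (BlkCubeY)
open Literature.MathematicalPhysics.QuantumFieldTheory.Balaban1983to89.B9CubeGeometryInputs (geoCK geoCK_len geoCK_eta_pos geoCK_eta levelGap_geoCK RM1)

variable {d ℓ : ℕ} {hd : 1 ≤ d + 1} {hL : Odd (ℓ + 1) ∧ 1 < ℓ + 1} {b₀ b₁ : ℝ}
variable {𝔸 : Type} [NormedRing 𝔸] [NormedAlgebra ℂ 𝔸] [CompleteSpace 𝔸]
variable (i : KIdx d ℓ hd hL b₀ b₁) (c : ↥(cubes (toKT i).D.toDomains))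

/-! ## §1  Dictionary: `Ṽ_□ = e^{iηÃ}·1` is r06's product configuration over the trivial background; def-Y's holonomy is the (3.1) plaquette word -/

/-- `Ṽ_□ = (U′U)` with `U = 1`, `U′ = e^{iηÃ}`, `Ã = χ̃_□A`. [cite: Balaban1985BackgroundPropagators, Cor. 3.6 p.408, p.396 before (3.37)] -/
theorem locCfgY_eq_prodCfg (η : ℝ) (A : AfldY 𝔸 i) :
    locCfgY i c η A = prodCfg (fun (_ : Fin (d + 1)) (_ : Site (PV d ℓ i.m i.K hd hL) 0) => (1 : 𝔸ˣ)) η (cutFldY i (chiTY i c) A) := by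
  funext κ x
  rw [locCfgY_apply, prodCfg, mul_one]

/-- def-Y's holonomy IS the (3.1) plaquette word of the torus translations. [cite: Balaban1985BackgroundPropagators, (3.1) p.390] -/
theorem holY_eq_plaqU (V : CfgY 𝔸 i) (x : Site (PV d ℓ i.m i.K hd hL) 0) {μ ν : Fin (d + 1)} (h : μ < ν) :
    holY i V ⟨x, μ, ν, h⟩ = plaqU (shiftsV1 (PV d ℓ i.m i.K hd hL)) V μ ν x := rfl

omit [CompleteSpace 𝔸] in
/-- `‖Re H − 1‖ ≤ ‖H − 1‖` for a bi-contractive holonomy `H`. [cite: Balaban1985BackgroundPropagators, p.404 below (3.69) (Re after (3.7) p.391)] -/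
theorem norm_re_sub_one_le {H : 𝔸ˣ} (hH : ‖((H⁻¹ : 𝔸ˣ) : 𝔸)‖ ≤ 1) :
    ‖(1 / 2 : ℂ) • ((H : 𝔸) + ((H⁻¹ : 𝔸ˣ) : 𝔸)) - 1‖ ≤ ‖(H : 𝔸) - 1‖ := by
  have e : (1 / 2 : ℂ) • ((H : 𝔸) + ((H⁻¹ : 𝔸ˣ) : 𝔸)) - 1 = (1 / 2 : ℂ) • (((H : 𝔸) - 1) + (((H⁻¹ : 𝔸ˣ) : 𝔸) * (1 - (H : 𝔸)))) := by
    rw [mul_sub, mul_one, Units.inv_mul]; module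
  rw [e, norm_smul]
  have hn : ‖(1 / 2 : ℂ)‖ = 1 / 2 := by simp
  rw [hn]
  have t := norm_add_le ((H : 𝔸) - 1) (((H⁻¹ : 𝔸ˣ) : 𝔸) * (1 - (H : 𝔸)))
  have t2 : ‖((H⁻¹ : 𝔸ˣ) : 𝔸) * (1 - (H : 𝔸))‖ ≤ ‖(H : 𝔸) - 1‖ := by
    refine (norm_mul_le _ _).trans ?_
    rw [norm_sub_rev]
    exact (mul_le_mul_of_nonneg_right hH (norm_nonneg _)).trans (by rw [one_mul])
  linarith

omit [CompleteSpace 𝔸] in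
/-- `‖Im H‖ ≤ ‖H − 1‖` for a bi-contractive holonomy `H`. [cite: Balaban1985BackgroundPropagators, p.404 below (3.69) (Im after (3.7) p.391)] -/
theorem norm_im_le {H : 𝔸ˣ} (hH : ‖((H⁻¹ : 𝔸ˣ) : 𝔸)‖ ≤ 1) :
    ‖(-Complex.I / 2) • ((H : 𝔸) - ((H⁻¹ : 𝔸ˣ) : 𝔸))‖ ≤ ‖(H : 𝔸) - 1‖ := by
  have e : (H : 𝔸) - ((H⁻¹ : 𝔸ˣ) : 𝔸) = ((H : 𝔸) - 1) - ((H⁻¹ : 𝔸ˣ) : 𝔸) * (1 - (H : 𝔸)) := by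
    rw [mul_sub, mul_one, Units.inv_mul]; abel
  rw [e, norm_smul]
  have hn : ‖(-Complex.I / 2)‖ = 1 / 2 := by simp
  rw [hn]
  have t := norm_sub_le ((H : 𝔸) - 1) (((H⁻¹ : 𝔸ˣ) : 𝔸) * (1 - (H : 𝔸)))
  have t2 : ‖((H⁻¹ : 𝔸ˣ) : 𝔸) * (1 - (H : 𝔸))‖ ≤ ‖(H : 𝔸) - 1‖ := by
    refine (norm_mul_le _ _).trans ?_
    rw [norm_sub_rev]
    exact (mul_le_mul_of_nonneg_right hH (norm_nonneg _)).trans (by rw [one_mul])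
  linarith

/-- the PLAQUETTE windows on `Re U(∂p) − 1` and `Im U(∂p)` follow from the one on `U(∂p) − 1` (bi-contractive holonomy).
[cite: Balaban1985BackgroundPropagators, p.404 below (3.69)] -/
theorem norm_reHolY_imHolY_le (V : CfgY 𝔸 i) (p : PlaqY i) (hH : ‖(((holY i V p)⁻¹ : 𝔸ˣ) : 𝔸)‖ ≤ 1) :
    ‖reHolY i V p - 1‖ ≤ ‖(holY i V p : 𝔸) - 1‖ ∧ ‖imHolY i V p‖ ≤ ‖(holY i V p : 𝔸) - 1‖ :=
  ⟨norm_re_sub_one_le hH, norm_im_le hH⟩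

/-! ## §2  The BOND window (W1) and the VARIATION window (W2) from local readings of `Ã` -/

section NormOne

variable [NormOneClass 𝔸]

omit [NormOneClass 𝔸] in
/-- the bond variable of `e^{iηÃ}·1` is the exponential. [cite: Balaban1985BackgroundPropagators, p.396 before (3.37)] -/
theorem val_prodCfg_one (η : ℝ) (A : AfldY 𝔸 i) (κ : Fin (d + 1)) (z : Site (PV d ℓ i.m i.K hd hL) 0) :
    (prodCfg (fun (_ : Fin (d + 1)) (_ : Site (PV d ℓ i.m i.K hd hL) 0) => (1 : 𝔸ˣ)) η A κ z : 𝔸) = NormedSpace.exp (((I * η : ℂ)) • A κ z) := by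
  rw [val_prodCfg, Units.val_one, mul_one]

/-- ★ **(W1) THE BOND WINDOW**: `‖Ṽ_κ(y) − 1‖ ≤ η‖Ã_κ(y)‖·e^{η‖Ã_κ(y)‖}` — from `e^{X} − e^{0}`. [cite: Balaban1985BackgroundPropagators, (3.37) p.396, (3.70) p.404] -/
theorem norm_prodCfg_one_sub_one_le {η : ℝ} (hη : 0 ≤ η) (A : AfldY 𝔸 i) (κ : Fin (d + 1)) (y : Site (PV d ℓ i.m i.K hd hL) 0) :
    ‖(prodCfg (fun (_ : Fin (d + 1)) (_ : Site (PV d ℓ i.m i.K hd hL) 0) => (1 : 𝔸ˣ)) η A κ y : 𝔸) - 1‖ ≤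
      η * ‖A κ y‖ * Real.exp (η * ‖A κ y‖) := by
  rw [val_prodCfg_one]
  have h := Literature.Analysis.Complex.norm_exp_sub_exp_le (((I * η : ℂ)) • A κ y) (0 : 𝔸)
  rw [NormedSpace.exp_zero, sub_zero, norm_zero, B12Membership314.norm_I_mul_smul hη, max_eq_left (mul_nonneg hη (norm_nonneg _))] at h
  exact h

/-- ★ **(W2) THE VARIATION WINDOW**: `‖Ṽ_κ(y) − Ṽ_κ(y′)‖ ≤ η‖Ã_κ(y) − Ã_κ(y′)‖·e^{r}` when `η‖Ã_κ‖ ≤ r` at both points — the `|∇^η_UA| < α₁(Lʲη)⁻²` reading of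
(3.37) makes this `O(α₁η²∕(Lʲη)²)`. [cite: Balaban1985BackgroundPropagators, (3.37) p.396, (3.71) p.404 (the `|∇A|` term)] -/
theorem norm_prodCfg_one_sub_le {η r : ℝ} (hη : 0 ≤ η) (A : AfldY 𝔸 i) (κ : Fin (d + 1)) (y y' : Site (PV d ℓ i.m i.K hd hL) 0)
    (hy : η * ‖A κ y‖ ≤ r) (hy' : η * ‖A κ y'‖ ≤ r) :
    ‖(prodCfg (fun (_ : Fin (d + 1)) (_ : Site (PV d ℓ i.m i.K hd hL) 0) => (1 : 𝔸ˣ)) η A κ y : 𝔸) -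
        prodCfg (fun (_ : Fin (d + 1)) (_ : Site (PV d ℓ i.m i.K hd hL) 0) => (1 : 𝔸ˣ)) η A κ y'‖ ≤
      η * ‖A κ y - A κ y'‖ * Real.exp r := by
  rw [val_prodCfg_one, val_prodCfg_one]
  have h := Literature.Analysis.Complex.norm_exp_sub_exp_le (((I * η : ℂ)) • A κ y) (((I * η : ℂ)) • A κ y')
  rw [← smul_sub, B12Membership314.norm_I_mul_smul hη, B12Membership314.norm_I_mul_smul hη, B12Membership314.norm_I_mul_smul hη] at h
  refine h.trans ?_
  have hmax : max (η * ‖A κ y‖) (η * ‖A κ y'‖) ≤ r := max_le hy hy'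
  gcongr

end NormOne

/-! ## §3  (W3) THE PLAQUETTE WINDOW from r06's second-order plaquette bound for `e^{iηÃ}` over the trivial background -/

/-- ★ **(W3) THE PLAQUETTE WINDOW**: at `p = p_{μν}(y)`, if `‖Ã_μ(y)‖, ‖Ã_ν(y)‖ ≤ c∕λ` and the forward differences `‖Ã_ν(y+e_μ) − Ã_ν(y)‖, ‖Ã_μ(y+e_ν) − Ã_μ(y)‖ ≤ ηc∕λ²`
(`η ≤ λ`), then `‖Ṽ(∂p) − 1‖ ≤ e^{6cη∕λ}(2c + 18c²)(η∕λ)²` (r06's `norm_fluct_plaq_sub_one_le_xi` at the torus translations), and the same bound for `‖Re Ṽ(∂p) − 1‖`,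
`‖Im Ṽ(∂p)‖` when the holonomy is bi-contractive. [cite: Balaban1985BackgroundPropagators, (3.69) p.404, (3.37) p.396, (3.1) p.390] -/
theorem norm_holY_prodCfg_sub_one_le {η lam cA : ℝ} (hη : 0 < η) (hηl : η ≤ lam) (A : AfldY 𝔸 i) (x : Site (PV d ℓ i.m i.K hd hL) 0)
    {μ ν : Fin (d + 1)} (h : μ < ν)
    (h₁ : ‖A μ x‖ ≤ cA * lam⁻¹) (h₄ : ‖A ν x‖ ≤ cA * lam⁻¹)
    (hDμ : ‖A ν (x.shift μ) - A ν x‖ ≤ η * (cA * (lam ^ 2)⁻¹)) (hDν : ‖A μ (x.shift ν) - A μ x‖ ≤ η * (cA * (lam ^ 2)⁻¹)) :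
    ‖(holY i (prodCfg (fun (_ : Fin (d + 1)) (_ : Site (PV d ℓ i.m i.K hd hL) 0) => (1 : 𝔸ˣ)) η A) ⟨x, μ, ν, h⟩ : 𝔸) - 1‖ ≤
      Real.exp (6 * cA * (η / lam)) * (2 * cA + 18 * cA ^ 2) * (η / lam) ^ 2 := by
  rw [holY_eq_plaqU]
  refine norm_fluct_plaq_sub_one_le_xi (shiftsV1 (PV d ℓ i.m i.K hd hL)) hη hηl h₁ h₄ ?_ ?_
  · rw [covD, B9Eq39Adjoint.R_one]; exact hDμ
  · rw [covD, B9Eq39Adjoint.R_one]; exact hDν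


/-! ## §4  Level slack in the distance-2 block neighbourhood: blocks at graph distance `≤ 2` differ by at most one level («M sufficiently large»: `R·L·M_h > 3`),
so a window at a point's own block scale is a window at any neighbouring block's scale up to one factor `L` -/

/-- ★ blocks within block-graph distance `2` have levels differing by `≤ 1` once `RM1 = R·L·M_h − 1 > 2` ([4] (2.2)∕(2.60) for the cube sequence).
[cite: Balaban1984PropagatorsII, (2.2) p.224, Lemma 2.1 (2.60) p.234; Balaban1985BackgroundPropagators, p.408 («This sequence satisfies the conditions (2.1), (2.2)»)] -/
theorem scale_sub_le_one_of_dist_le_two (hM : 2 < RM1 i) {a a' : BlkCubeY i c} (h : (geoCK i c).dist a a' ≤ 2) :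
    |((a.1.1 : ℕ) : ℝ) - ((a'.1.1 : ℕ) : ℝ)| ≤ 1 := by
  have hg := levelGap_geoCK i c a a'
  change RM1 i * max (|((a.1.1 : ℕ) : ℝ) - ((a'.1.1 : ℕ) : ℝ)| - 1) 0 ≤ (geoCK i c).dist a a' at hg
  by_contra hlt
  push Not at hlt
  -- the level difference is an integer `≥ 2`
  have hint : (2 : ℝ) ≤ |((a.1.1 : ℕ) : ℝ) - ((a'.1.1 : ℕ) : ℝ)| := by
    have e : |((a.1.1 : ℕ) : ℝ) - ((a'.1.1 : ℕ) : ℝ)| = (((|(a.1.1 : ℤ) - (a'.1.1 : ℤ)| : ℤ)) : ℝ) := by push_cast; rfl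
    rw [e] at hlt ⊢
    have h1 : (1 : ℤ) < |(a.1.1 : ℤ) - (a'.1.1 : ℤ)| := by exact_mod_cast hlt
    exact_mod_cast h1
  have hmax : (1 : ℝ) ≤ max (|((a.1.1 : ℕ) : ℝ) - ((a'.1.1 : ℕ) : ℝ)| - 1) 0 := le_max_of_le_left (by linarith)
  have : RM1 i * 1 ≤ RM1 i * max (|((a.1.1 : ℕ) : ℝ) - ((a'.1.1 : ℕ) : ℝ)| - 1) 0 :=
    mul_le_mul_of_nonneg_left hmax (B9CubeGeometryInputs.RM1_nonneg i)
  linarith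

/-- ★ hence their lengths differ by at most one factor `L`: `len(a′) ≤ L·len(a)`. [cite: Balaban1984PropagatorsII, (2.2) p.224, (2.16) p.225] -/
theorem len_le_L_mul_len_of_dist_le_two (hM : 2 < RM1 i) {a a' : BlkCubeY i c} (h : (geoCK i c).dist a a' ≤ 2) :
    (geoCK i c).len a' ≤ ((ℓ : ℝ) + 1) * (geoCK i c).len a := by
  have hs := scale_sub_le_one_of_dist_le_two i c hM h
  have hle : (a'.1.1 : ℕ) ≤ a.1.1 + 1 := by
    have h1 : ((a'.1.1 : ℕ) : ℝ) - ((a.1.1 : ℕ) : ℝ) ≤ 1 := by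
      have := neg_abs_le (((a.1.1 : ℕ) : ℝ) - ((a'.1.1 : ℕ) : ℝ)); linarith
    have h2 : ((a'.1.1 : ℕ) : ℝ) ≤ ((a.1.1 + 1 : ℕ) : ℝ) := by push_cast; linarith
    exact_mod_cast h2
  rw [geoCK_len, geoCK_len]
  have hη := geoCK_eta_pos i c
  rw [geoCK_eta] at hη
  have hL1 : (1 : ℝ) ≤ (ℓ : ℝ) + 1 := by linarith [(Nat.cast_nonneg ℓ : (0 : ℝ) ≤ ℓ)]
  calc ((ℓ : ℝ) + 1) ^ a'.1.1 * (B6KLevelCensusIndexV1.kGeo i).eta ≤ ((ℓ : ℝ) + 1) ^ (a.1.1 + 1) * (B6KLevelCensusIndexV1.kGeo i).eta := by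
        exact mul_le_mul_of_nonneg_right (pow_le_pow_right₀ hL1 hle) hη.le
    _ = ((ℓ : ℝ) + 1) * (((ℓ : ℝ) + 1) ^ a.1.1 * (B6KLevelCensusIndexV1.kGeo i).eta) := by ring

end Literature.MathematicalPhysics.QuantumFieldTheory.Balaban1983to89.B9Cor36GCubeWindowsPointwise

end
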